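import Summits.QuantumFields.YangMills.Theorems.UnitScaleTiltHalvingP1FlatPillarRows
import Summits.QuantumFields.YangMills.Theorems.UnitScaleTiltProp8HalvingChartP1FlatRows
import HarnessLib

/-!
# Route `UnitScaleTilt`, crux K1 child «MinimiserStabilityRegPr» (stmt-QuantumFields-19200), registered stub V2′ `stub_halvingStep` (v8∕v10 `BirthV10`) —
# **PILLAR P1♭ END TO END ON THE P1 SIDE: THE PACKAGE ROWS OF M3 FROM THE CORE** (★★OWNER ACK 38 (c): the consumer-side check of ★w7-19200 g0's
# ✓ `HalvingChartP1FlatRows.package_rows_of_P1FlatPillarAt` against ✓ `HalvingP1FlatPillar.hP1_of_P1FlatPillarAt` ∕ ✓ `HalvingP1FlatPillarRows.p1FlatPillarAt_of_core`,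
# done as a kernel-checked composition)

Cell `ym3-torus` (HUMAN RULING D-0037, YM ladder rung R3 — continuum SU(2) YM₃ on the torus is a RUNG, not the Clay problem), width seat `ym-ust-19200-w3` gen 4.
`--supports stmt-QuantumFields-19200 --as helper`; def-free, 0 sorry, standard axioms.

WHAT THIS FILE PROVES (no definition, no sorry): ★★ `package_rows_of_core` — from the CORE of pillar P1♭ (WANTED №g26-5 displayed VERBATIM: `∃ u A, DP1Clause ∧ (i) ∧
(ii) ∧ (iii) ∧ (iv)` at the cube sequence of `x`), the side data (`R′M ≤ S`, `2L ≤ R′M + 1`, `U ∈ 𝔅_k(V)`, `PlaqSmall ε₁ V`, `0 ≤ ε₁`, `0 < ε₀`, the two regimes),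
the level weights and M3's `H`∕`C` letters: M3's package rows for the chart field `A′ = A + H(C A)` (self-adjointness, the layer chart identity, tracelessness, the
slice, the two (152) letters with `δ = δ′ = B₁ε₀`), the seventh conjunct ((160)♭ near row with `C₁ = 6`) and the D-P1 clause — i.e. everything the halving package's
P1-side sockets ask, modulo the one displayed hypothesis `core`.  The check passes by `exact`: the three files compose without adapters.
HONEST SCOPE.  Composition only; the core (Thm 2♭ in the double-bar chart) is a hypothesis.  NOT a claim about the stub, the crux, the rung or the mass gap.

References: T. Bałaban, CMP **99** (1985) 75–102 [Balaban1985RegularSpaces] Thm 2 p.83, (1.36)–(1.38) p.82; CMP **102** (1985) 277–309 [Balaban1985Variational]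
(152)–(156) pp.301–302, (160) p.303, (165) p.304.
-/

set_option autoImplicit false

noncomputable section

open scoped BigOperators Matrix.Norms.L2Operator

namespace Summit.QuantumFields.YangMills.Theorems.HalvingP1FlatPillarPackage

open Literature.MathematicalPhysics.QuantumFieldTheory.Balaban1983to89
open Literature.MathematicalPhysics.QuantumFieldTheory.Balaban1983to89.T3ContinuumYM3Torus
open Literature.MathematicalPhysics.QuantumFieldTheory.Balaban1983to89.T3UnitLawDensityEML (ℰp)
open Literature.MathematicalPhysics.QuantumFieldTheory.Balaban1983to89.T3ConstrainedMinimiser (fibre)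
open Complex (I)
open B5Eq117TorusCarriers (Mk)
open B5Eq118OneStroke (iterBlockOf)
open B5Prop12FieldsLattice (distSite)
open B6SectADomainsV1 (Domains)
open B6SectAOperatorsV1 (BondIdx SiteIdx RE dsE)
open B7Prop1Explicit (expUnit)
open B8Eq140Level (SideTouches)
open B8Thm2SetupTorus (pullDom)
open B10Eq27TorusAxialLog (transl unitsField toUField)
open LatticeFieldCalculus (laplace diverg siteAvgIter)
open FlatCubeOpsText (IsLevWeight)
open FlatOpsLettersAssembly (flatH)
open FlatCubeSequenceAligned (cubeSeqMT3)
open HalvingP1FlatPillar (DP1Clause P1FlatPillarAt)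
open HalvingP1FlatPillarRows (p1FlatPillarAt_of_core)
open HalvingChartP1FlatRows (package_rows_of_P1FlatPillarAt)
open Summit.QuantumFields.YangMills.Theorems.Prop8ChartDoubleBar (chartLogFlat)

variable {F : T3Family} {n K : ℕ}

section PackageFromCore

/-- ★★ **THE PACKAGE ROWS FROM THE CORE** (end-to-end on the P1 side): the CORE of pillar P1♭ (WANTED №g26-5, displayed verbatim) at the cube sequence of `x`, the side
data of `p1FlatPillarAt_of_core`, the level weights and the `H`∕`C` letters of M3 ⟹ M3's package rows for `A′ = A + H(C A)` (sa, layer chart identity, tracelessness,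
slice, the two (152) letters with `δ = δ′ = B₁ε₀`), the seventh conjunct ((160)♭ near row, `C₁ = 6`) and the D-P1 clause — ✓`p1FlatPillarAt_of_core` ∘ ★w7-19200 g0's
✓`HalvingChartP1FlatRows.package_rows_of_P1FlatPillarAt`. [cite: Balaban1985RegularSpaces, Thm 2 p.83; Balaban1985Variational, (152)-(160) pp.301-303, (165) p.304] -/
theorem package_rows_of_core (hnK : n < K) (x : Site (F.P K) 0) (ρ S M : ℕ) (hM : 1 ≤ M) {R' : ℕ} (hRS : R' * M ≤ S)
    (hRM : 2 * (F.P K).L ≤ R' * M + 1) {ε₀ ε₁ B₁ : ℝ} (hε₁ : 0 ≤ ε₁) (hε₀ : 0 < ε₀)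
    (hreg₁ : 12 * ((ρ : ℝ) + (M : ℝ)) * ε₁ ≤ 1)
    (hreg₀ : 16 * 3800 * ((((F.P K).d + 2) * (F.P K).L : ℕ) : ℝ) ^ 2 * (F.L : ℝ) * ((B₁ + 1) * ε₀) ≤ 1)
    {V : GaugeField (F.P n) 0 (Matrix.specialUnitaryGroup (Fin 2) ℂ)} {U : GaugeField (F.P K) 0 (Matrix.specialUnitaryGroup (Fin 2) ℂ)}
    (hU : U ∈ fibre F ℰp n K hnK.le V) (hV : PlaqSmall ε₁ V)
    (core : ∃ (u : GaugeTransf (F.P K) 0 (Matrix.unitaryGroup (Fin 2) ℂ)) (A : PBond (F.P K) 0 → Matrix (Fin 2) (Fin 2) ℂ),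
      DP1Clause F n K (cubeSeqMT3 F n K x ρ S M hM) x U u ∧
      (∀ b : PBond (F.P K) 0, IsSelfAdjoint (A b)) ∧ (∀ b : PBond (F.P K) 0, Matrix.trace (A b) = 0) ∧
      (∀ j, 1 ≤ j → j ≤ K - n → ∀ (z : B7Prop1Explicit.Site (F.P K).d) (μ : Fin (F.P K).d),
        SideTouches (pullDom (fun i => {y : Site (F.P K) 0 | (cubeSeqMT3 F n K x ρ S M hM).InOm i y}) j) z μ →
        (Unitary.toUnits (u (transl 0 z)))⁻¹ * unitsField (toUField U) ⟨transl 0 z, μ⟩ * Unitary.toUnits (u ((transl 0 z).shift μ)) =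
          expUnit (I • ((((F.L : ℝ)⁻¹) ^ (K - n)) • A ⟨transl 0 z, μ⟩))) ∧
      (∀ w : ℕ → PBond (F.P K) 0 → ℝ, IsLevWeight F n K (cubeSeqMT3 F n K x ρ S M hM) w →
        (∀ b : PBond (F.P K) 0, w 1 b * ‖A b‖ ≤ B₁ * ε₀) ∧
        (∀ (b : PBond (F.P K) 0) (ν : Fin (F.P K).d), w 2 b * (F.L : ℝ) ^ (K - n) * ‖A ⟨b.src.shift ν, b.dir⟩ - A b‖ ≤ B₁ * ε₀)) ∧
      (∃ μ : SiteIdx (cubeSeqMT3 F n K x ρ S M hM) → Matrix (Fin 2) (Fin 2) ℂ, ∀ s : Site (F.P K) 0,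
        laplace ((F.L : ℝ) ^ (K - n)) (diverg ((F.L : ℝ) ^ (K - n)) A) s =
          ∑ i : SiteIdx (cubeSeqMT3 F n K x ρ S M hM), siteAvgIter (i.1.1 : ℕ) (Pi.single s (1 : ℝ)) i.1.2 • μ i))
    {w : ℕ → PBond (F.P K) 0 → ℝ} (hw : IsLevWeight F n K (cubeSeqMT3 F n K x ρ S M hM) w)
    (C : (PBond (F.P K) 0 → Matrix (Fin 2) (Fin 2) ℂ) → (BondIdx (cubeSeqMT3 F n K x ρ S M hM) → Matrix (Fin 2) (Fin 2) ℂ)) {B_H B_H' C₂' R : ℝ}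
    (hH : ∀ (X : BondIdx (cubeSeqMT3 F n K x ρ S M hM) → Matrix (Fin 2) (Fin 2) ℂ) (t : ℝ), (∀ i, ‖X i‖ ≤ t) →
      ∀ b, w 1 b * ‖∑ c, flatH F n K (cubeSeqMT3 F n K x ρ S M hM) (Pi.single c 1) b • X c‖ ≤ B_H * t)
    (hH' : ∀ (X : BondIdx (cubeSeqMT3 F n K x ρ S M hM) → Matrix (Fin 2) (Fin 2) ℂ) (t : ℝ), (∀ i, ‖X i‖ ≤ t) →
      ∀ (b : PBond (F.P K) 0) (ν : Fin (F.P K).d),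
        w 2 b * (F.L : ℝ) ^ (K - n) *
          ‖(∑ c, flatH F n K (cubeSeqMT3 F n K x ρ S M hM) (Pi.single c 1) ⟨b.src.shift ν, b.dir⟩ • X c) -
            ∑ c, flatH F n K (cubeSeqMT3 F n K x ρ S M hM) (Pi.single c 1) b • X c‖ ≤ B_H' * t)
    (hCq : ∀ (Y : PBond (F.P K) 0 → Matrix (Fin 2) (Fin 2) ℂ) (r : ℝ), r < R → (∀ b, w 1 b * ‖Y b‖ ≤ r) → ∀ i, ‖C Y i‖ ≤ C₂' * r ^ 2)
    (hCtr : ∀ (Y : PBond (F.P K) 0 → Matrix (Fin 2) (Fin 2) ℂ), (∀ b, Matrix.trace (Y b) = 0) → ∀ i, Matrix.trace (C Y i) = 0)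
    (hδR : B₁ * ε₀ < R) :
    ∃ (u : GaugeTransf (F.P K) 0 (Matrix.unitaryGroup (Fin 2) ℂ)) (A : PBond (F.P K) 0 → Matrix (Fin 2) (Fin 2) ℂ),
      ((∀ b : PBond (F.P K) 0, IsSelfAdjoint (A b)) ∧
        (∀ (z : B7Prop1Explicit.Site (F.P K).d) (μ : Fin (F.P K).d),
          SideTouches (pullDom (fun j => if K - n ≤ j then ({x} : Set (Site (F.P K) 0)) else (∅ : Set (Site (F.P K) 0))) (K - n)) z μ →
          (Unitary.toUnits (u (transl 0 z)))⁻¹ * unitsField (toUField U) ⟨transl 0 z, μ⟩ * Unitary.toUnits (u ((transl 0 z).shift μ)) =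
            expUnit (I • ((((F.L : ℝ)⁻¹) ^ (K - n)) • A ⟨transl 0 z, μ⟩)))) ∧
      (∀ b, Matrix.trace ((A + fun b => ∑ c, flatH F n K (cubeSeqMT3 F n K x ρ S M hM) (Pi.single c 1) b • C A c) b) = 0) ∧
      (∀ φ : Matrix (Fin 2) (Fin 2) ℂ →ₗ[ℝ] ℝ,
        RE (cubeSeqMT3 F n K x ρ S M hM) ((F.L : ℝ) ^ (K - n)) (dsE ((F.L : ℝ) ^ (K - n))
          (WithLp.toLp 2 (fun b => φ ((A + fun b => ∑ c, flatH F n K (cubeSeqMT3 F n K x ρ S M hM) (Pi.single c 1) b • C A c) b)))) = 0) ∧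
      (∀ b, w 1 b * ‖(A + fun b => ∑ c, flatH F n K (cubeSeqMT3 F n K x ρ S M hM) (Pi.single c 1) b • C A c) b‖ ≤ B₁ * ε₀ + B_H * (C₂' * (B₁ * ε₀) ^ 2)) ∧
      (∀ (b : PBond (F.P K) 0) (ν : Fin (F.P K).d),
        w 2 b * (F.L : ℝ) ^ (K - n) *
          ‖(A + fun b => ∑ c, flatH F n K (cubeSeqMT3 F n K x ρ S M hM) (Pi.single c 1) b • C A c) ⟨b.src.shift ν, b.dir⟩ -
            (A + fun b => ∑ c, flatH F n K (cubeSeqMT3 F n K x ρ S M hM) (Pi.single c 1) b • C A c) b‖ ≤ B₁ * ε₀ + B_H' * (C₂' * (B₁ * ε₀) ^ 2)) ∧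
      (∀ c : BondIdx (cubeSeqMT3 F n K x ρ S M hM), (c.1.1 : ℕ) = K - n →
        c.1.2.src ∈ (cubeSeqMT3 F n K x ρ S M hM).Om (c.1.1 : ℕ) → c.1.2.tgt ∈ (cubeSeqMT3 F n K x ρ S M hM).Om (c.1.1 : ℕ) →
        ‖chartLogFlat (((F.L : ℝ)⁻¹) ^ (K - n)) (cubeSeqMT3 F n K x ρ S M hM) A c‖ ≤
          6 * ε₁ * (distSite (Mk (F.P K) (c.1.1 : ℕ)) c.1.2.src (iterBlockOf (c.1.1 : ℕ) x) + 1)) ∧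
      DP1Clause F n K (cubeSeqMT3 F n K x ρ S M hM) x U u :=
  package_rows_of_P1FlatPillarAt hnK x ρ S M hM (p1FlatPillarAt_of_core hnK x ρ S M hM hRS hRM hε₁ hε₀ hreg₁ hreg₀ hU hV core) hw C hH hH' hCq hCtr hδR

end PackageFromCore

end Summit.QuantumFields.YangMills.Theorems.HalvingP1FlatPillarPackage

end
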